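import Summits.BirchSwinnertonDyer.BirchSwinnertonDyer.Theorems.PrintCf2RamifiedOffTYZQFormEvenForest
import Summits.BirchSwinnertonDyer.BirchSwinnertonDyer.Theorems.PrintCf2RamifiedOffTYZQFormIdentity
import Literature.NumberTheory.EllipticCurves.Smith2016.CongruentNumberGenusDeterminantEvenForest
import Literature.NumberTheory.EllipticCurves.CongruentNumberOddMonskySelmerLocal
import HarnessLib

/-!
# Route `PrintCf2`, crux stmt-BirchSwinnertonDyer-20509 `RamifiedOffTYZOfFacts` — **THE IDENTITY (★)₆ FOR MONSKY'S EVEN MATRIX** (`n ≡ 6 (mod 8)`)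
# (cell `bsd-print-cf2`, LEAD of 20509 g9, line `offtyz-v7`, cycle 10; kernel helpers `--supports stmt-BirchSwinnertonDyer-20509`)

Second (Monsky-data) layer of programme F2 of the even mover programme (crux workfile `Cruxes/RamifiedOffTYZOfFacts/Lines/offtyz_v7_SevenSector.md`
§9–§10; the LEAD g8 discovered and instrument-checked (★)₆ on 2616 instances; this seat re-checked it on 4566 with its own transcription,
`instruments/check_star6.py`). For distinct odd primes `p₁, …, p_k` with `∏ pᵢ ≡ 3 (mod 4)` (so `n = 2p₁⋯p_k ≡ 6 (mod 8)`), Monsky's even matrix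
`M = [[Aᵀ + D₂, D₋₁],[D₂, A + D₂]]` (`HeathBrown1994.monskyMatrixEven`), `a i j = A i j`, `t = ((−1/pᵢ)₊)`, `z = ((2/pᵢ)₊)`:

  **(★)₆**  `adj(M)_{(inl i)(inr i)} = Σ_{S ∋ i, Σ_S t = 1} det((A_S + D₋₂)[col i ← t_S]) · det M_{d_{Sᶜ}}`
            (`det M_{d_{Sᶜ}} = QForm.coblockWeight p S`, Monsky's ODD matrix of the co-block; `A_S + D₋₂ = L_S + D_{t+z}`).

* §1 `adjugate_monskyMatrixEven_inl_inr`: `M·Sw = B := bigN a univ t z z` (tree `monskyMatrixEven_mul_swap`), `adj Sw = Sw`, so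
  `adj(M)_{(inl i)(inr i)} = adj(B)_{(inr i)(inr i)}`.
* §2 `bigN_submatrix_swap` (abstract): exchanging the two copies transposes the weights — under the reciprocity law on an EVEN `D`,
  `Sw·bigN a D y z ℓ·Sw = bigN aᵀ D z y (ℓ + t)`; hence (`det_bigN_self_eq_coblockWeight`) for `Σ_T t = 0`:
  `det bigN a T z z z = det bigN aᵀ T z z (z + t) = det bigN aᵀ T z z z` (root shift by `t`: every shifted term has an odd pointed block,
  killed by the reciprocity lemma, or an odd complement, killed by parity) `= coblockWeight p Tᶜ` (tree `coblockWeight_eq_det_bigN`).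
* §3 **(★)₆** (`adjugate_monskyMatrixEven_inl_inr_eq_sum`): §1 + the forest form (tree `adjugate_bigN_mark_inr_inr_eq_sum_odd`, previous file)
  + §2 on every even co-block; `…_eq_sum_filter` is the same sum over `univ.powerset.filter (i ∈ S ∧ Σ_S t = 1)`.
* §4 census coordinates (`det_updateCol_lap_eq_det_updateCol_block`): the ambient Cramer determinant `det((lap a S (t+z))[col i ← t·1_S])` equals
  `det((blockLegendreMatrix p S + legendreDiagonal (blockPrimes p S) (−2))[col i ← t])` on `Fin #S` (block-triangular determinant + re-indexing
  along `S.orderIsoOfFin`), the form in which the block law of `…MoverBlockFormSix` reads it.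
USE (programme F3, next): for `#Sel₂(E_n) = 8` the kernel line of `M` is `u`, `adj M = u (Ju)ᵀ`, `adj_{(inl i)(inr i)} = u¹ᵢ`; (★)₆ turns `u¹ᵢ`
into the `τ(1)`-coefficient of `(gg)·P(n) − P(n)` for `g` with Kummer bits `e₂ + e_{pᵢ}` (block law p704973 on the even blocks in the genus
regime, TYZ Thm 1.1 for `|𝓛(n/d_S)| ≡ coblockWeight`), and the even door p677864 gives `ord = rank = 1`, `Ш[2^∞] = 0`, `BSD(E_n, 2)`.
Pure linear algebra over `𝔽₂` + quadratic reciprocity; no `sorry`. BSD is not proved by any of this; no class is closed.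

References: [cite: HeathBrown1994SelmerCongruentII, Appendix (Monsky), typescript p. 39 L10 – p. 41 L36]; [cite: Smith2016CongruentDensity, §2.2];
[cite: Chaiken1982, §2]; [cite: HornJohnson2013, §0.8.2]; crux notes `Lines/offtyz_v7_SevenSector.md` §9–§10.
-/

namespace Summit.BirchSwinnertonDyer.PrintCf2.QFormForest

open Matrix Finset Literature.LinearAlgebra.Matrix Literature.Combinatorics.Enumerative
open Literature.NumberTheory.EllipticCurves.Smith2016

variable {V : Type*} [Fintype V] [LinearOrder V]

/-! ## §2 (abstract part). Exchanging the two copies transposes the weights -/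

omit [Fintype V] [LinearOrder V] in
/-- **Exchanging the two copies of an even block transposes the weights**: under the reciprocity law on `D` with `Σ_D t = 0`,
`(bigN a D y z ℓ)` conjugated by the copy swap is `bigN aᵀ D z y (ℓ + t)` (`lapIn aᵀ D (ℓ + t) = (lapIn a D ℓ)ᵀ`: off the diagonal this
is the definition of `aᵀ`, on the diagonal the row and column sums of `a` differ by `tᵢ · Σ_{D∖i} t = tᵢ · tᵢ = tᵢ`).
[cite: HeathBrown1994SelmerCongruentII, Appendix (Monsky), typescript p. 39 L34–L41 (row versus column sums of A under (31))] [cite: Chaiken1982, §2] -/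
theorem bigN_submatrix_swap [DecidableEq V] (a : V → V → ZMod 2) (t y z ℓ : V → ZMod 2) {D : Finset V}
    (hrec : ∀ i ∈ D, ∀ j ∈ D, i ≠ j → a i j + a j i = t i * t j) (htD : ∑ i ∈ D, t i = 0) :
    (bigN a D y z ℓ).submatrix Sum.swap Sum.swap = bigN (fun i j => a j i) D z y (fun i => ℓ i + t i) := by
  have hsq : ∀ x : ZMod 2, x * x = x := by decide
  -- the diagonal bookkeeping: `Σ_{D∖i} a i k = Σ_{D∖i} a k i + t i` for `i ∈ D`
  have hdiag : ∀ i ∈ D, ℓ i + ∑ k ∈ D.erase i, a i k = (ℓ i + t i) + ∑ k ∈ D.erase i, a k i := by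
    intro i hi
    have hpair : ∀ k ∈ D.erase i, a i k = a k i + t i * t k := by
      intro k hk
      have h := hrec i hi k (mem_of_mem_erase hk) (ne_of_mem_erase hk).symm
      have e : ∀ u v w : ZMod 2, u + v = w → u = v + w := by decide
      exact e _ _ _ h
    rw [sum_congr rfl hpair, sum_add_distrib, ← mul_sum]
    have hrest : ∑ k ∈ D.erase i, t k = t i := by
      have h := add_sum_erase D t hi
      rw [htD] at h
      have e : ∀ u v : ZMod 2, u + v = 0 → v = u := by decide
      exact e _ _ h
    rw [hrest, hsq]
    ring
  have hlap : ∀ i j, lapIn a D ℓ i j = lapIn (fun i j => a j i) D (fun i => ℓ i + t i) j i := by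
    intro i j
    rw [lapIn_apply, lapIn_apply]
    by_cases hD : i ∈ D ∧ j ∈ D
    · have hD' : j ∈ D ∧ i ∈ D := ⟨hD.2, hD.1⟩
      rw [if_pos hD, if_pos hD']
      by_cases hij : i = j
      · subst hij; rw [if_pos rfl, if_pos rfl, hdiag i hD.1]
      · rw [if_neg hij, if_neg (Ne.symm hij)]
    · rw [if_neg hD, if_neg (fun h => hD ⟨h.2, h.1⟩)]
  ext (i | i) (j | j)
  · rw [submatrix_apply, Sum.swap_inl, Sum.swap_inl, bigN_inr_inr, bigN_inl_inl]
  · rw [submatrix_apply, Sum.swap_inl, Sum.swap_inr, bigN_inr_inl, bigN_inl_inr, hlap]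
  · rw [submatrix_apply, Sum.swap_inr, Sum.swap_inl, bigN_inl_inr, bigN_inr_inl, hlap]
  · rw [submatrix_apply, Sum.swap_inr, Sum.swap_inr, bigN_inl_inl, bigN_inr_inr]

/-- **Root shift by the reciprocity vector costs nothing on an even block**: under the reciprocity law on `T` with `Σ_T t = 0`,
`det bigN a T z z (z + t) = det bigN a T z z z` — in `setExp(fwt a z z (z + t)) = Σ_E setExp(q_t)(E) · setExp(fwt a z z z)(T ∖ E)` (root
absorption) a nonempty pointed part `E` weighs `(Σ_E t) q_t(E)` (reciprocity lemma), so `E` is odd, and then `T ∖ E` is odd and nonempty and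
`det bigN a (T∖E) z z z = 0` (parity). [cite: Chaiken1982, §2] [cite: Smith2016CongruentDensity, §2.2 (source cnc2.tex l. 36–40)] -/
theorem det_bigN_self_root_shift (a : V → V → ZMod 2) (t z : V → ZMod 2) {T : Finset V}
    (hrec : ∀ i ∈ T, ∀ j ∈ T, i ≠ j → a i j + a j i = t i * t j) (htT : ∑ i ∈ T, t i = 0) :
    (bigN a T z z (fun i => z i + t i)).det = (bigN a T z z z).det := by
  rw [det_bigN_eq_setExp, det_bigN_eq_setExp, setExp_fwt_add_root, ← add_sum_erase _ _ (empty_mem_powerset T), setExp_empty,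
    one_mul, sdiff_empty]
  suffices h0 : ∑ E ∈ T.powerset.erase ∅, setExp (qwt a t) E * setExp (fwt a z z z) (T \ E) = 0 by rw [h0, add_zero]
  refine sum_eq_zero fun E hE => ?_
  obtain ⟨hEne, hET⟩ := mem_erase.mp hE
  rw [mem_powerset] at hET
  have hEne' : E.Nonempty := nonempty_iff_ne_empty.mpr hEne
  rw [setExp_qwt_eq_sum_mul_qwt a t hEne' (hrec_mono hET hrec)]
  by_cases htE : ∑ i ∈ E, t i = 1
  · -- odd pointed part: the complement is odd and nonempty
    have hsplit : ∑ i ∈ T, t i = ∑ i ∈ E, t i + ∑ i ∈ T \ E, t i := by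
      rw [← sum_union disjoint_sdiff, union_sdiff_of_subset hET]
    rw [htT, htE] at hsplit
    have hR : ∑ i ∈ T \ E, t i = 1 := by
      have e : ∀ u : ZMod 2, 0 = 1 + u → u = 1 := by decide
      exact e _ hsplit
    rw [← det_bigN_eq_setExp, det_bigN_self_eq_zero a t z (T \ E) (hrec_mono sdiff_subset hrec) (nonempty_of_sum_eq_one hR) (Or.inl hR),
      mul_zero]
  · have h0 : ∑ i ∈ E, t i = 0 := by
      have h01 : ∀ u : ZMod 2, u ≠ 1 → u = 0 := by decide
      exact h01 _ htE
    rw [h0, zero_mul, zero_mul]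

section MonskyEven

open Literature.NumberTheory.EllipticCurves.HeathBrown1994 Literature.NumberTheory.EllipticCurves.MonskySelmerParity
open Summit.BirchSwinnertonDyer.PrintCf2.QForm

variable {k : ℕ} (p : Fin k → ℕ) (hp : ∀ i, (p i).Prime) (hp2 : ∀ i, p i ≠ 2) (hinj : Function.Injective p)

/-! ## §1. The column swap: `adj(M_even)_{(inl i)(inr i)} = adj(bigN a univ t z z)_{(inr i)(inr i)}` -/

/-- The block swap is an involution. [cite: HeathBrown1994SelmerCongruentII, Appendix (Monsky), typescript p. 40 L19–L24] -/
theorem fromBlocks_swap_mul_self :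
    fromBlocks (0 : Matrix (Fin k) (Fin k) (ZMod 2)) (1 : Matrix (Fin k) (Fin k) (ZMod 2)) (1 : Matrix (Fin k) (Fin k) (ZMod 2)) (0 : Matrix (Fin k) (Fin k) (ZMod 2)) * fromBlocks (0 : Matrix (Fin k) (Fin k) (ZMod 2)) (1 : Matrix (Fin k) (Fin k) (ZMod 2)) (1 : Matrix (Fin k) (Fin k) (ZMod 2)) (0 : Matrix (Fin k) (Fin k) (ZMod 2)) = 1 := by
  rw [fromBlocks_multiply]; simp

/-- The block swap is its own adjugate (`adj Sw · Sw = det Sw · 1 = 1` and `Sw² = 1`). [cite: HornJohnson2013, §0.8.2] -/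
theorem adjugate_fromBlocks_swap :
    (fromBlocks (0 : Matrix (Fin k) (Fin k) (ZMod 2)) (1 : Matrix (Fin k) (Fin k) (ZMod 2)) (1 : Matrix (Fin k) (Fin k) (ZMod 2)) (0 : Matrix (Fin k) (Fin k) (ZMod 2))).adjugate = fromBlocks (0 : Matrix (Fin k) (Fin k) (ZMod 2)) (1 : Matrix (Fin k) (Fin k) (ZMod 2)) (1 : Matrix (Fin k) (Fin k) (ZMod 2)) (0 : Matrix (Fin k) (Fin k) (ZMod 2)) := by
  have h := adjugate_mul (fromBlocks (0 : Matrix (Fin k) (Fin k) (ZMod 2)) (1 : Matrix (Fin k) (Fin k) (ZMod 2)) (1 : Matrix (Fin k) (Fin k) (ZMod 2)) (0 : Matrix (Fin k) (Fin k) (ZMod 2)))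
  rw [det_fromBlocks_swap, one_smul] at h
  calc (fromBlocks (0 : Matrix (Fin k) (Fin k) (ZMod 2)) (1 : Matrix (Fin k) (Fin k) (ZMod 2)) (1 : Matrix (Fin k) (Fin k) (ZMod 2)) (0 : Matrix (Fin k) (Fin k) (ZMod 2))).adjugate
      = (fromBlocks (0 : Matrix (Fin k) (Fin k) (ZMod 2)) (1 : Matrix (Fin k) (Fin k) (ZMod 2)) (1 : Matrix (Fin k) (Fin k) (ZMod 2)) (0 : Matrix (Fin k) (Fin k) (ZMod 2))).adjugate *
          (fromBlocks (0 : Matrix (Fin k) (Fin k) (ZMod 2)) (1 : Matrix (Fin k) (Fin k) (ZMod 2)) (1 : Matrix (Fin k) (Fin k) (ZMod 2)) (0 : Matrix (Fin k) (Fin k) (ZMod 2)) * fromBlocks (0 : Matrix (Fin k) (Fin k) (ZMod 2)) (1 : Matrix (Fin k) (Fin k) (ZMod 2)) (1 : Matrix (Fin k) (Fin k) (ZMod 2)) (0 : Matrix (Fin k) (Fin k) (ZMod 2))) := by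
        rw [fromBlocks_swap_mul_self, Matrix.mul_one]
    _ = fromBlocks (0 : Matrix (Fin k) (Fin k) (ZMod 2)) (1 : Matrix (Fin k) (Fin k) (ZMod 2)) (1 : Matrix (Fin k) (Fin k) (ZMod 2)) (0 : Matrix (Fin k) (Fin k) (ZMod 2)) := by rw [← Matrix.mul_assoc, h, Matrix.one_mul]

/-- **The column swap**: `adj(M_even)_{(inl i)(inr i)} = adj(B)_{(inr i)(inr i)}` for `B = bigN a univ t z z = M_even · Sw`
(`adj B = adj Sw · adj M = Sw · adj M`). [cite: HeathBrown1994SelmerCongruentII, Appendix (Monsky), typescript p. 41 L20–L36] [cite: HornJohnson2013, §0.8.2] -/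
theorem adjugate_monskyMatrixEven_inl_inr (i : Fin k) :
    (monskyMatrixEven p).adjugate (Sum.inl i) (Sum.inr i) =
      (bigN (fun i j => legendreMatrix p i j) univ (fun i => addLegendreSym (-1) (p i)) (fun i => addLegendreSym 2 (p i))
        (fun i => addLegendreSym 2 (p i))).adjugate (Sum.inr i) (Sum.inr i) := by
  rw [← monskyMatrixEven_mul_swap p, adjugate_mul_distrib, adjugate_fromBlocks_swap, Matrix.mul_apply, Fintype.sum_sum_type]
  simp only [fromBlocks_apply₂₁, fromBlocks_apply₂₂, Matrix.zero_apply, zero_mul, sum_const_zero, add_zero, Matrix.one_apply,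
    ite_mul, one_mul]
  rw [Finset.sum_ite_eq univ i, if_pos (mem_univ i)]

/-! ## §2. `det bigN a T z z z = coblockWeight p Tᶜ` on an even block -/

include hp hp2 hinj in
/-- **The symmetric Monsky form of an even co-block is Monsky's determinant**: for `T` with `Σ_T (−1/pᵢ)₊ = 0`,
`det bigN a T z z z = coblockWeight p Tᶜ = det M_{d_T}` (`a` = UNtransposed additive Legendre weights; the tree's
`coblockWeight_eq_det_bigN` is the transposed form `det bigN aᵀ T z z z`, and the two agree by the copy swap and a free root shift).
[cite: HeathBrown1994SelmerCongruentII, Appendix (Monsky), typescript p. 39 L27–L41] [cite: Chaiken1982, §2] -/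
theorem det_bigN_self_eq_coblockWeight (T : Finset (Fin k)) (hT : ∑ i ∈ T, addLegendreSym (-1) (p i) = 0) :
    (bigN (fun i j => legendreMatrix p i j) T (fun i => addLegendreSym 2 (p i)) (fun i => addLegendreSym 2 (p i))
        (fun i => addLegendreSym 2 (p i))).det = coblockWeight p Tᶜ := by
  have hrec := hrec_mono (subset_univ T) (hrec_legendre p hp hp2 hinj)
  have hrecT := hrec_mono (subset_univ T) (hrec_legendreT p hp hp2 hinj)
  rw [← det_submatrix_equiv_self (Equiv.sumComm (Fin k) (Fin k)),
    show (bigN (fun i j => legendreMatrix p i j) T (fun i => addLegendreSym 2 (p i)) (fun i => addLegendreSym 2 (p i))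
        (fun i => addLegendreSym 2 (p i))).submatrix (Equiv.sumComm (Fin k) (Fin k)) (Equiv.sumComm (Fin k) (Fin k)) =
      (bigN (fun i j => legendreMatrix p i j) T (fun i => addLegendreSym 2 (p i)) (fun i => addLegendreSym 2 (p i))
        (fun i => addLegendreSym 2 (p i))).submatrix Sum.swap Sum.swap from rfl,
    bigN_submatrix_swap _ _ _ _ _ hrec hT, det_bigN_self_root_shift _ _ _ hrecT hT,
    coblockWeight_eq_det_bigN p hp hp2 hinj Tᶜ (by rw [compl_compl]; exact hT), compl_compl]

/-! ## §3. (★)₆ -/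

include hp hp2 hinj in
/-- **(★)₆ FOR MONSKY'S EVEN MATRIX** (pointed-powerset form): for distinct odd primes with `∏ pᵢ ≡ 3 (mod 4)` (`Σ t = 1`) and every `i`,
`adj(M_even)_{(inl i)(inr i)} = Σ_{S₀ ⊆ univ∖i} (Σ_S t) · det((lap a S (t+z))[col i ← t·1_S]) · coblockWeight p S`, `S = {i} ∪ S₀`
(`lap a S (t+z) = A_S + D₋₂` padded by the identity; `coblockWeight p S = det M_{d_{Sᶜ}}`).
[cite: HeathBrown1994SelmerCongruentII, Appendix (Monsky), typescript p. 39 L10 – p. 41 L36] [cite: Chaiken1982, §2] [cite: Smith2016CongruentDensity, §2.2] -/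
theorem adjugate_monskyMatrixEven_inl_inr_eq_sum (h3 : ∑ i, addLegendreSym (-1) (p i) = 1) (i : Fin k) :
    (monskyMatrixEven p).adjugate (Sum.inl i) (Sum.inr i) =
      ∑ S₀ ∈ (univ.erase i).powerset, (∑ m ∈ insert i S₀, addLegendreSym (-1) (p m)) *
        ((lap (fun i j => legendreMatrix p i j) (insert i S₀) (fun j => addLegendreSym (-1) (p j) + addLegendreSym 2 (p j))).updateCol i
          (fun r => if r ∈ insert i S₀ then addLegendreSym (-1) (p r) else 0)).det *
        coblockWeight p (insert i S₀) := by
  classical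
  rw [adjugate_monskyMatrixEven_inl_inr,
    adjugate_bigN_mark_inr_inr_eq_sum_odd _ _ _ (hrec_legendre p hp hp2 hinj) h3 (mem_univ i)]
  refine sum_congr rfl fun S₀ hS₀ => ?_
  rw [mem_powerset] at hS₀
  by_cases hS : ∑ m ∈ insert i S₀, addLegendreSym (-1) (p m) = 1
  · -- odd block: the co-block is even
    have hsplit := sum_eq_sum_insert_add_sum_sdiff (fun m => addLegendreSym (-1) (p m)) (mem_univ i) hS₀
    rw [h3, hS] at hsplit
    have hT : ∑ m ∈ univ.erase i \ S₀, addLegendreSym (-1) (p m) = 0 := by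
      have e : ∀ u : ZMod 2, 1 = 1 + u → u = 0 := by decide
      exact e _ hsplit
    rw [det_bigN_self_eq_coblockWeight p hp hp2 hinj _ hT, erase_sdiff_eq_sdiff_insert, ← compl_eq_univ_sdiff, compl_compl]
  · have h0 : ∑ m ∈ insert i S₀, addLegendreSym (-1) (p m) = 0 := by
      have h01 : ∀ u : ZMod 2, u ≠ 1 → u = 0 := by decide
      exact h01 _ hS
    rw [h0]; ring

include hp hp2 hinj in
/-- **(★)₆, filter form**: `adj(M_even)_{(inl i)(inr i)} = Σ_{S ⊆ univ, i ∈ S, Σ_S t = 1} det((lap a S (t+z))[col i ← t·1_S]) · coblockWeight p S`.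
[cite: HeathBrown1994SelmerCongruentII, Appendix (Monsky), typescript p. 39 L10 – p. 41 L36] [cite: Chaiken1982, §2] -/
theorem adjugate_monskyMatrixEven_inl_inr_eq_sum_filter (h3 : ∑ i, addLegendreSym (-1) (p i) = 1) (i : Fin k) :
    (monskyMatrixEven p).adjugate (Sum.inl i) (Sum.inr i) =
      ∑ S ∈ (univ : Finset (Fin k)).powerset.filter (fun S => i ∈ S ∧ ∑ m ∈ S, addLegendreSym (-1) (p m) = 1),
        ((lap (fun i j => legendreMatrix p i j) S (fun j => addLegendreSym (-1) (p j) + addLegendreSym 2 (p j))).updateCol i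
          (fun r => if r ∈ S then addLegendreSym (-1) (p r) else 0)).det * coblockWeight p S := by
  classical
  rw [adjugate_monskyMatrixEven_inl_inr_eq_sum p hp hp2 hinj h3 i,
    sum_powerset_filter_mem_and_eq _ (mem_univ i) (fun S => ∑ m ∈ S, addLegendreSym (-1) (p m) = 1), sum_filter]
  refine sum_congr rfl fun S₀ _ => ?_
  by_cases h : ∑ m ∈ insert i S₀, addLegendreSym (-1) (p m) = 1
  · rw [if_pos h, h, one_mul]
  · have h0 : ∑ m ∈ insert i S₀, addLegendreSym (-1) (p m) = 0 := by
      have h01 : ∀ u : ZMod 2, u ≠ 1 → u = 0 := by decide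
      exact h01 _ h
    rw [if_neg h, h0, zero_mul, zero_mul]

/-! ## §4. Census coordinates of the Cramer determinant -/

omit [LinearOrder V] in
/-- **Re-indexing a column-replaced Laplacian block**: for `i ∈ S`, `e : Fin m ≃ S` and a replacement column supported on `S`,
`det((lap a S ℓ)[col i ← v·1_S]) = det((lap a' univ ℓ')[col e⁻¹(i) ← v ∘ e])` on `Fin m` (`a' = a ∘ (e × e)`, `ℓ' = ℓ ∘ e`): outside `S` the
matrix has unit rows. [cite: ChebotarevAgaev2002, §3 Thm. 2] [cite: HornJohnson2013, §0.8.2] -/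
theorem det_updateCol_lap_eq_reindex [DecidableEq V] (a : V → V → ZMod 2) (ℓ v : V → ZMod 2) {S : Finset V} {i : V} (hi : i ∈ S)
    {m : ℕ} (e : Fin m ≃ {x // x ∈ S}) :
    ((lap a S ℓ).updateCol i (fun r => if r ∈ S then v r else 0)).det =
      ((lap (fun x y => a (e x : V) (e y : V)) (univ : Finset (Fin m)) (fun x => ℓ (e x : V))).updateCol (e.symm ⟨i, hi⟩)
        (fun x => v (e x : V))).det := by
  set X := (lap a S ℓ).updateCol i (fun r => if r ∈ S then v r else 0) with hX
  have hout : ∀ r, r ∉ S → ∀ c, X r c = if r = c then 1 else 0 := by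
    intro r hr c
    rw [hX, updateCol_apply]
    by_cases hci : c = i
    · rw [if_pos hci, if_neg hr, if_neg]
      rintro rfl
      rw [hci] at hr
      exact hr hi
    · rw [if_neg hci, lap_apply, if_neg (fun h => hr h.1)]
  rw [twoBlockTriangular_det X (fun x => x ∈ S)
    (fun r hr c hc => by rw [hout r hr c, if_neg (by rintro rfl; exact hr hc)])]
  have hone : X.toSquareBlockProp (fun x => ¬ x ∈ S) = 1 := by
    ext ⟨r, hr⟩ ⟨c, hc⟩
    rw [toSquareBlockProp_def, Matrix.of_apply, hout r hr c, Matrix.one_apply]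
    by_cases hrc : r = c
    · subst hrc; simp
    · rw [if_neg hrc, if_neg (fun h => hrc (congrArg Subtype.val h))]
  rw [hone, det_one, mul_one]
  have hinj : ∀ x y : Fin m, ((e x : V) = (e y : V)) ↔ x = y := fun x y => ⟨fun h => e.injective (Subtype.ext h), fun h => by rw [h]⟩
  have hei : ∀ y : Fin m, ((e y : V) = i) ↔ y = e.symm ⟨i, hi⟩ := by
    intro y
    constructor
    · intro h; apply e.injective; rw [Equiv.apply_symm_apply]; exact Subtype.ext h
    · intro h; rw [h, Equiv.apply_symm_apply]
  have hre : (X.toSquareBlockProp (fun x => x ∈ S)).submatrix e e =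
      (lap (fun x y => a (e x : V) (e y : V)) (univ : Finset (Fin m)) (fun x => ℓ (e x : V))).updateCol (e.symm ⟨i, hi⟩)
        (fun x => v (e x : V)) := by
    ext x y
    rw [submatrix_apply, toSquareBlockProp_def, Matrix.of_apply, hX, updateCol_apply, updateCol_apply]
    simp only [hei]
    by_cases hy : y = e.symm ⟨i, hi⟩
    · rw [if_pos hy, if_pos hy, if_pos (e x).2]
    · rw [if_neg hy, if_neg hy, lap_apply, lap_apply]
      simp only [(e x).2, (e y).2, and_self, if_true, mem_univ, hinj]
      by_cases hxy : x = y
      · subst hxy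
        rw [if_pos rfl, if_pos rfl]
        congr 1
        refine sum_bij' (fun k hk => e.symm ⟨k, mem_of_mem_erase hk⟩) (fun y' _ => (e y' : V)) ?_ ?_ ?_ ?_ ?_
        · intro k hk
          rw [mem_erase] at hk ⊢
          refine ⟨fun h => hk.1 ?_, mem_univ _⟩
          have := congrArg (fun x => ((e x : {x // x ∈ S}) : V)) h
          simpa using this
        · intro y' hy'
          rw [mem_erase] at hy' ⊢
          exact ⟨fun h => hy'.1 (e.injective (Subtype.ext h)), (e y').2⟩
        · intro k hk; simp
        · intro y' _; simp
        · intro k hk; simp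
      · rw [if_neg hxy, if_neg hxy]
  have h := det_submatrix_equiv_self e (X.toSquareBlockProp (fun x => x ∈ S))
  rw [hre] at h
  convert h.symm using 2

include hp hp2 in
/-- **The census coordinates of the Cramer determinant**: for `i ∈ S`,
`det((lap a S (t+z))[col i ← t·1_S]) = det((A_S + D₋₂(S))[col i ← t_S])` with `A_S = blockLegendreMatrix p S`, `D₋₂(S) =
legendreDiagonal (blockPrimes p S) (−2)`, `t_S = ((−1/q)₊)` on the sub-tuple `q = blockPrimes p S` (increasing re-indexing `S.orderIsoOfFin`;
`(−2/q)₊ = (−1/q)₊ + (2/q)₊`). This is the form read by the block law `MoverAssembly.sqMotion_eq_kerSum_dotProduct_bits_six`.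
[cite: HeathBrown1994SelmerCongruentII, Appendix (Monsky), typescript p. 39 L10–L26] [cite: IrelandRosen1990, Ch. 5 §1 Prop. 5.1.2] -/
theorem det_updateCol_lap_eq_det_updateCol_block {S : Finset (Fin k)} {i : Fin k} (hi : i ∈ S) :
    ((lap (fun i j => legendreMatrix p i j) S (fun j => addLegendreSym (-1) (p j) + addLegendreSym 2 (p j))).updateCol i
        (fun r => if r ∈ S then addLegendreSym (-1) (p r) else 0)).det =
      ((blockLegendreMatrix p S + legendreDiagonal (blockPrimes p S) (-2)).updateCol ((S.orderIsoOfFin rfl).symm ⟨i, hi⟩)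
        (fun x => addLegendreSym (-1) (blockPrimes p S x))).det := by
  set e := (S.orderIsoOfFin rfl).toEquiv with he
  rw [det_updateCol_lap_eq_reindex _ _ _ hi e]
  congr 1
  have hmat : lap (fun x y => legendreMatrix p (e x : Fin k) (e y : Fin k)) (univ : Finset (Fin S.card))
      (fun x => addLegendreSym (-1) (p (e x : Fin k)) + addLegendreSym 2 (p (e x : Fin k))) =
      blockLegendreMatrix p S + legendreDiagonal (blockPrimes p S) (-2) := by
    ext x y
    rw [lap_apply, Matrix.add_apply, blockLegendreMatrix, legendreDiagonal, diagonal_apply]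
    simp only [mem_univ, and_self, if_true]
    have hq : ∀ x, blockPrimes p S x = p (e x : Fin k) := fun x => rfl
    by_cases hxy : x = y
    · subst hxy
      rw [if_pos rfl, if_pos rfl, Families.legendreMatrix_apply_self, hq,
        Literature.NumberTheory.EllipticCurves.CongruentNumberOddMonskySelmer.addLegendreSym_neg_two (hp _) (hp2 _)]
      have hsum : ∑ y ∈ univ.erase x, legendreMatrix p (e x : Fin k) (e y : Fin k) =
          ∑ y ∈ univ.erase x, legendreMatrix (blockPrimes p S) x y := by
        refine sum_congr rfl fun y hy => ?_
        rw [Families.legendreMatrix_apply_of_ne p (fun h => (ne_of_mem_erase hy).symm (e.injective (Subtype.ext h))),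
          Families.legendreMatrix_apply_of_ne (blockPrimes p S) (ne_of_mem_erase hy).symm, hq, hq]
      rw [hsum]; ring
    · rw [if_neg hxy, if_neg hxy, add_zero,
        Families.legendreMatrix_apply_of_ne p (fun h => hxy (e.injective (Subtype.ext h))),
        Families.legendreMatrix_apply_of_ne (blockPrimes p S) hxy, hq, hq]
  rw [hmat]
  rfl

end MonskyEven

end Summit.BirchSwinnertonDyer.PrintCf2.QFormForest
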